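import Summits.AtomisticToContinuum.FouriersLaw.Theorems.BondHeatUncertaintyExtensiveSnapshotIrreversibilityKernelFacts
import Summits.AtomisticToContinuum.FouriersLaw.Theorems.BondHeatUncertaintyExtensiveSnapshotIrreversibilityCorrectorIntegrability
import Summits.AtomisticToContinuum.FouriersLaw.Theorems.BondHeatUncertaintyExtensiveSnapshotIrreversibilityMcLennanIdentification
import Summits.AtomisticToContinuum.FouriersLaw.Theorems.BondHeatUncertaintyExtensiveSnapshotIrreversibilityResponseDensity
import Summits.AtomisticToContinuum.FouriersLaw.Theorems.OddSectorIrreversibilityOddDensityIsCorrector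
import Summits.AtomisticToContinuum.FouriersLaw.Theorems.OddSectorIrreversibilityOddResponseBoundIntensive
import Literature.MathematicalPhysics.KineticTheory.LangevinChainNESSHolds
import HarnessLib

/-!
# Crux `ExtensiveSnapshotIrreversibility` (stmt-AtomisticToContinuum-9121), line `clausius-budget-sound-window`:
the odd corrector bound S4o FROM A CUBIC BOUND ON THE ODD KUBO CORRECTOR OF THE TOTAL CURRENT (c4 lead's reshaping S4o → S4k)

The `N`-uniform stub S4o `stub_oddCorrectorBound` of the line (`∫ (w − w∘Θ)² dμ_T ≤ C·N` for the McLennan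
corrector `w = ∫₀^∞ P_s g ds`, `g = (γ/2T²)(p_0² − p_{N−1}²)`, both baths at `T`) is EQUIVALENT, by the landed
McLennan identification (S1a, p91177), the landed response density (S1b, p95551 = sibling item 9144) and the sibling
route's PROVED McLennan / Kundu–Dhar–Narayan identity `OddDensityIsCorrector` (item 9146:
`h − h∘Θ = (u − u∘Θ)/((N−1)T²)` a.e. for the Kubo corrector `u = ∫₀^∞ P_t J_tot dt` of the TOTAL current), to a
CUBIC bound on the odd part of the Kubo corrector: `∫ (u − u∘Θ)² dμ_T ≤ C·N³`. This file proves the reduction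
`oddCorrectorBound_of_kuboCorrectorOddCubic` (S4o ⟸ S4k), so that the crux's whole `N`-uniform content is now stated
in the CURRENCY OF THE SIBLING ROUTE `OddSectorIrreversibility`: its rank-2 crux E1 `ConeScaleCorrector`
(stmt-AtomisticToContinuum-14069, `∫ u² ≤ C·N²·Z` over the unnormalised Gibbs weight) implies S4k with a factor `N`
and the even sector to spare (`kuboCorrectorOddCubic_of_coneScale`, hypothesis = E1's definiens verbatim, so that the
route file under edit is not imported by name). One `N`-uniform open problem now serves both routes; (K) is the
WEAKER consumer (cubic, odd sector only — order-tight at the harmonic corner, `∫(u − u∘Θ)² ≍ N³/3`, where E1's `N²`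
fails as its own docstring records).

Proof of the reduction: choose a steady-state family (`pinnedChain_exists_isSteadyState`, CEHR 2018 in tree); S1b
gives a response density `h`; under the guard `μ_{N,T,T} = μ_T`; 9146 gives `u ∈ L²(μ_T)` with the finite-horizon
Kubo integrals converging to it a.e. and `h − h∘Θ = (u − u∘Θ)/((N−1)T²)` a.e.; S4k bounds `∫(u − u∘Θ)² ≤ C N³`;
S1a (with (INV), (MIX) from S0 and `w ∈ L²` from S2a) turns `∫(h − h∘Θ)²` into `∫(w − w∘Θ)²`; finally
`N³/((N−1)²T⁴) ≤ 4N/T⁴` for `N ≥ 2`.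
-/

noncomputable section

namespace Summit.AtomisticToContinuum.FouriersLaw.Theorems.ExtensiveSnapshotIrreversibility.ClausiusBudget

open MeasureTheory Filter Topology
open scoped ENNReal NNReal
open Literature.MathematicalPhysics.KineticTheory.HeatConduction

/-- Real arithmetic: `N³/((N−1)²) ≤ 4N` for `N ≥ 2`, in the form used below. [folklore] -/
theorem cube_div_sq_pred_le {N : ℕ} (hN : 2 ≤ N) {C T : ℝ} (hC : 0 ≤ C) (hT : 0 < T) :
    C * (N : ℝ) ^ 3 / (((N : ℝ) - 1) ^ 2 * T ^ 4) ≤ 4 * C / T ^ 4 * N := by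
  have hN1 : (1 : ℝ) ≤ (N : ℝ) - 1 := by
    have : (2 : ℝ) ≤ N := by exact_mod_cast hN
    linarith
  have hN0 : (0 : ℝ) ≤ N := by positivity
  have hT4 : 0 < T ^ 4 := by positivity
  have hden : 0 < ((N : ℝ) - 1) ^ 2 * T ^ 4 := by positivity
  rw [div_le_iff₀ hden]
  -- `C N³ ≤ 4C/T⁴ · N · ((N-1)² T⁴) = 4 C N (N-1)²`
  have hkey : (N : ℝ) ^ 3 ≤ 4 * N * ((N : ℝ) - 1) ^ 2 := by nlinarith
  calc C * (N : ℝ) ^ 3 ≤ C * (4 * N * ((N : ℝ) - 1) ^ 2) := mul_le_mul_of_nonneg_left hkey hC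
    _ = 4 * C / T ^ 4 * N * (((N : ℝ) - 1) ^ 2 * T ^ 4) := by field_simp

/-- **S4o from S4k** (c4 lead, 2026-08-16): a cubic `N`-uniform bound `∫ (u − u∘Θ)² dμ_T ≤ C·N³` on the odd part of
the Kubo corrector `u` of the total current (any `L²(μ_T)` a.e.-limit of the finite-horizon Kubo integrals
`∫₀^τ P_t J_tot dt`, the predicate of `OddDensityIsCorrector` / `ConeScaleCorrector` over the normalised Gibbs measure)
implies the line's stub S4o: `∫ (w − w∘Θ)² dμ_T ≤ (4·max C 0/T⁴)·N` for the McLennan corrector `w`, all `N ≥ 2`.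
Uses the landed S0, S1a, S1b, S2a and the sibling's proved `oddDensityIsCorrector_proof`. [folklore] -/
theorem oddCorrectorBound_of_kuboCorrectorOddCubic :
    (∀ ω₂ lam β γ : ℝ, 0 < ω₂ → 0 < lam → 0 < β → 0 < γ → ∀ T : ℝ, 0 < T → ∃ C : ℝ,
      ∀ (N : ℕ) (u : PhaseSpace N → ℝ), 2 ≤ N →
        let P := pinnedChain ω₂ lam β γ
        let μT := P.gibbsMeasure N T
        let J : PhaseSpace N → ℝ := fun z => ∑ i : Fin N, P.bondCurrent N i z
        MemLp u 2 μT →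
        (∀ᵐ x ∂μT, Tendsto (fun τ : ℝ => ∫ t in Set.Ioc (0 : ℝ) τ,
            (∫ y, J y ∂(P.transitionKernel N T T t.toNNReal x))) atTop (𝓝 (u x))) →
        ∫ x, (u x - u (x.1, -x.2)) ^ 2 ∂μT ≤ C * (N : ℝ) ^ 3) →
    ∀ ω₂ lam β γ : ℝ, 0 < ω₂ → 0 < lam → 0 < β → 0 < γ →
      (∀ (N : ℕ) (T_L T_R : ℝ), 0 < T_L → 0 < T_R → ∀ μ ν : Measure (PhaseSpace N),
        (pinnedChain ω₂ lam β γ).IsSteadyState N T_L T_R μ →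
        (pinnedChain ω₂ lam β γ).IsSteadyState N T_L T_R ν → μ = ν) →
      ∀ T : ℝ, 0 < T → ∃ C : ℝ, ∀ (N : ℕ) (hN : 2 ≤ N),
        let P := pinnedChain ω₂ lam β γ
        let μT := P.gibbsMeasure N T
        let g : PhaseSpace N → ℝ := fun y =>
          γ / (2 * T ^ 2) * (y.2 ⟨0, by omega⟩ ^ 2 - y.2 ⟨N - 1, by omega⟩ ^ 2)
        let Pg : ℝ → PhaseSpace N → ℝ := fun s z => ∫ y, g y ∂(P.transitionKernel N T T s.toNNReal z)
        let w : PhaseSpace N → ℝ := fun z => ∫ s in Set.Ioi (0 : ℝ), Pg s z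
        ∫ z, (w z - w (z.1, -z.2)) ^ 2 ∂μT ≤ C * N := by
  intro hK ω₂ lam β γ hω hl hβ hγ hU T hT
  obtain ⟨C, hC⟩ := hK ω₂ lam β γ hω hl hβ hγ T hT
  refine ⟨4 * max C 0 / T ^ 4, fun N hN => ?_⟩
  intro P μT g Pg w
  have hN0 : 0 < N := by omega
  -- a steady-state family (CEHR 2018, in tree), junk `0` at non-positive temperatures
  obtain ⟨μ, hμ⟩ : ∃ μ : (N : ℕ) → ℝ → ℝ → Measure (PhaseSpace N),
      ∀ (N : ℕ) (T_L T_R : ℝ), 0 < T_L → 0 < T_R →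
        (pinnedChain ω₂ lam β γ).IsSteadyState N T_L T_R (μ N T_L T_R) := by
    classical
    refine ⟨fun N a b => if h : 0 < a ∧ 0 < b then
      Classical.choose (pinnedChain_exists_isSteadyState hω hl hβ hγ N h.1 h.2) else 0, ?_⟩
    intro N a b ha hb
    simp only [dif_pos (And.intro ha hb)]
    exact Classical.choose_spec (pinnedChain_exists_isSteadyState hω hl hβ hγ N ha hb)
  -- the equal-temperature member is the Gibbs measure
  have hG : μ N T T = μT :=
    hU N T T hT hT _ _ (hμ N T T hT hT) (pinnedChain_isSteadyState_gibbsMeasure hω hl.le hβ.le γ N hT)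
  -- S0: (INV), (MIX); S2a: `w ∈ L²(μ_T)`
  obtain ⟨hInv, hMix⟩ := stub_equilibriumKernelFacts ω₂ lam β γ hω hl hβ hγ hU T hT N hN0
  obtain ⟨-, hw2, -⟩ := stub_correctorIntegrability ω₂ lam β γ hω hl hβ hγ T hT N hN hInv hMix
  -- S1b: a response density; S1a: its reversal asymmetry is that of `w`
  obtain ⟨h, hRD⟩ := stub_responseDensity ω₂ lam β γ hω hl hβ hγ hU μ hμ T hT N
  have hId : ∫ x, (h x - h (x.1, -x.2)) ^ 2 ∂(μ N T T) = ∫ z, (w z - w (z.1, -z.2)) ^ 2 ∂μT :=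
    stub_mcLennanIdentification ω₂ lam β γ hω hl hβ hγ hU μ hμ T hT N hN hInv hMix hw2 h hRD
  -- sibling 9146: the odd part of `h` is the normalised odd part of the Kubo corrector `u`
  obtain ⟨u, hu2, hulim, hueq⟩ :=
    OddSectorIrreversibility.oddDensityIsCorrector_proof ω₂ lam β γ hω hl hβ hγ hU μ hμ T hT N h hN hRD
  rw [hG] at hu2 hulim hueq
  -- S4k on `u`
  have hKu : ∫ x, (u x - u (x.1, -x.2)) ^ 2 ∂μT ≤ C * (N : ℝ) ^ 3 := hC N u hN hu2 hulim
  -- assemble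
  have hT2 : ((N : ℝ) - 1) * T ^ 2 ≠ 0 := by
    have : (2 : ℝ) ≤ N := by exact_mod_cast hN
    have h1 : (0 : ℝ) < (N : ℝ) - 1 := by linarith
    positivity
  have hstep : ∫ z, (w z - w (z.1, -z.2)) ^ 2 ∂μT =
      (∫ x, (u x - u (x.1, -x.2)) ^ 2 ∂μT) / (((N : ℝ) - 1) ^ 2 * T ^ 4) := by
    rw [← hId, hG]
    have hae : (fun x => (h x - h (x.1, -x.2)) ^ 2) =ᵐ[μT]
        fun x => (u x - u (x.1, -x.2)) ^ 2 / (((N : ℝ) - 1) ^ 2 * T ^ 4) := by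
      filter_upwards [hueq] with x hx
      rw [hx]
      field_simp
    rw [integral_congr_ae hae, integral_div]
  rw [hstep]
  have hN0' : (0 : ℝ) ≤ N := by positivity
  calc (∫ x, (u x - u (x.1, -x.2)) ^ 2 ∂μT) / (((N : ℝ) - 1) ^ 2 * T ^ 4)
      ≤ max C 0 * (N : ℝ) ^ 3 / (((N : ℝ) - 1) ^ 2 * T ^ 4) := by
        apply div_le_div_of_nonneg_right _ (by positivity)
        exact hKu.trans (mul_le_mul_of_nonneg_right (le_max_left _ _) (by positivity))
    _ ≤ 4 * max C 0 / T ^ 4 * N := cube_div_sq_pred_le hN (le_max_right _ _) hT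

/-- **S4k from the sibling crux E1** (`ConeScaleCorrector`, stmt-AtomisticToContinuum-14069, hypothesis stated as its
definiens verbatim): a bound `∫ u² d(e^{−H/T}dx) ≤ C·N²·Z` for every a.e.-limit `u` of the finite-horizon Kubo integrals
of the total current (unnormalised Gibbs weight, `Z` its mass) gives the cubic odd bound S4k over the normalised Gibbs
measure with constant `4C`: `∫ (u − u∘Θ)² dμ_T ≤ 4∫ u² dμ_T = 4Z⁻¹∫u² ≤ 4C N² ≤ 4C N³` (flip-invariance of `μ_T`,
`N ≥ 1`). [folklore] -/
theorem kuboCorrectorOddCubic_of_coneScale :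
    (∀ ω₂ lam β γ : ℝ, 0 < ω₂ → 0 < lam → 0 < β → 0 < γ → ∀ T : ℝ, 0 < T → ∃ C : ℝ,
      ∀ (N : ℕ) (u : PhaseSpace N → ℝ),
        let P := pinnedChain ω₂ lam β γ
        let μT : Measure (PhaseSpace N) := volume.withDensity
          (fun x : PhaseSpace N => ENNReal.ofReal (Real.exp (-(P.hamiltonian N x) / T)))
        let J : PhaseSpace N → ℝ := fun z => ∑ i : Fin N, P.bondCurrent N i z
        (∀ᵐ x ∂μT, Tendsto (fun τ : ℝ => ∫ t in Set.Ioc (0 : ℝ) τ,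
            (∫ y, J y ∂(P.transitionKernel N T T t.toNNReal x))) atTop (𝓝 (u x))) →
        MemLp u 2 μT ∧ ∫ x, (u x) ^ 2 ∂μT ≤
          C * (N : ℝ) ^ 2 * ∫ x, Real.exp (-(P.hamiltonian N x) / T) ∂volume) →
    ∀ ω₂ lam β γ : ℝ, 0 < ω₂ → 0 < lam → 0 < β → 0 < γ → ∀ T : ℝ, 0 < T → ∃ C : ℝ,
      ∀ (N : ℕ) (u : PhaseSpace N → ℝ), 2 ≤ N →
        let P := pinnedChain ω₂ lam β γ
        let μT := P.gibbsMeasure N T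
        let J : PhaseSpace N → ℝ := fun z => ∑ i : Fin N, P.bondCurrent N i z
        MemLp u 2 μT →
        (∀ᵐ x ∂μT, Tendsto (fun τ : ℝ => ∫ t in Set.Ioc (0 : ℝ) τ,
            (∫ y, J y ∂(P.transitionKernel N T T t.toNNReal x))) atTop (𝓝 (u x))) →
        ∫ x, (u x - u (x.1, -x.2)) ^ 2 ∂μT ≤ C * (N : ℝ) ^ 3 := by
  intro hE ω₂ lam β γ hω hl hβ hγ T hT
  obtain ⟨C, hC⟩ := hE ω₂ lam β γ hω hl hβ hγ T hT
  refine ⟨4 * max C 0, fun N u hN => ?_⟩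
  intro P μT J hu2 hulim
  -- the unnormalised weight is `Z •` the Gibbs measure (sibling bookkeeping, `OddResponseBound.Intensive`)
  set Z : ℝ := ∫ x, Real.exp (-(P.hamiltonian N x) / T) with hZ
  have hZpos : 0 < Z := OddResponseBound.Intensive.integral_gibbsWeight_pos hω hl.le hβ.le γ N hT
  have hsmul := OddResponseBound.Intensive.withDensity_gibbs_eq_smul_gibbsMeasure hω hl.le hβ.le γ N hT
  have hc0 : ENNReal.ofReal Z ≠ 0 := (ENNReal.ofReal_pos.mpr hZpos).ne'
  have hlimT := (OddResponseBound.Intensive.ae_smul_iff' hsmul hc0).mpr hulim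
  have hEu := hC N u
  dsimp only at hEu
  obtain ⟨-, hbound⟩ := hEu hlimT
  rw [OddResponseBound.Intensive.integral_eq_toReal_mul_of_eq_smul hsmul, ENNReal.toReal_ofReal hZpos.le]
    at hbound
  -- `∫ u² dμ_T ≤ C N²`
  have hu2b : ∫ x, (u x) ^ 2 ∂μT ≤ C * (N : ℝ) ^ 2 := by
    refine le_of_mul_le_mul_left ?_ hZpos
    calc Z * ∫ x, (u x) ^ 2 ∂μT ≤ C * (N : ℝ) ^ 2 * Z := hbound
      _ = Z * (C * (N : ℝ) ^ 2) := by ring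
  -- the odd part costs a factor `4` (flip-invariance of `μ_T`)
  have hodd : ∫ x, (u x - u (x.1, -x.2)) ^ 2 ∂μT ≤ 4 * ∫ x, (u x) ^ 2 ∂μT :=
    OddResponseBound.Intensive.integral_sub_comp_sq_le
      (OddSectorIrreversibility.measurePreserving_reversal_gibbsMeasure P N T) hu2
  have hN1 : (1 : ℝ) ≤ N := by exact_mod_cast (le_trans (by norm_num) hN)
  have hN0 : (0 : ℝ) ≤ N := by positivity
  have hsq : (N : ℝ) ^ 2 ≤ (N : ℝ) ^ 3 := by nlinarith
  calc ∫ x, (u x - u (x.1, -x.2)) ^ 2 ∂μT ≤ 4 * ∫ x, (u x) ^ 2 ∂μT := hodd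
    _ ≤ 4 * (max C 0 * (N : ℝ) ^ 2) := by
        refine mul_le_mul_of_nonneg_left ?_ (by norm_num)
        exact hu2b.trans (mul_le_mul_of_nonneg_right (le_max_left _ _) (by positivity))
    _ ≤ 4 * (max C 0 * (N : ℝ) ^ 3) := by
        have hm : 0 ≤ max C 0 := le_max_right _ _
        nlinarith [mul_le_mul_of_nonneg_left hsq hm]
    _ = 4 * max C 0 * (N : ℝ) ^ 3 := by ring

end Summit.AtomisticToContinuum.FouriersLaw.Theorems.ExtensiveSnapshotIrreversibility.ClausiusBudget

end
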